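import Literature.Geometry.Kaehler.ComplexTorusAnalyticIntersectionNumber
import HarnessLib

/-!
# The degree of an analytic subset of `X₁ × X₂` over `X₂`: generic fibres have `deg` points, finite special
# fibres have at most `deg` points

Layer `Literature/Geometry/Kaehler`; lane `lit-hodgefound`, seat p07, programme «REMMERT'S OPEN MAPPING
THEOREM AND THE POSITIVITY OF INTERSECTION MULTIPLICITIES», file 6: the fibre-dimension-ZERO case of
`ComplexTorusAnalyticFibreCycle` §5–§7, deduced from `ComplexTorusAnalyticIntersectionNumber` (intersection
numbers of complementary-dimensional analytic subsets are point counts) applied on `X₁ × X₂` to the pair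
`(X₁ × {t₀}, Z)`: the fibre `Z_t = {x | (x, t) ∈ Z}` of `pr₂ : Z → X₂` is the intersection of `Z` with the
translate `X₁ × {t}` of `X₁ × {0}`.

> [Fulton1998, Example 11.4.5, p. 207 / Appendix B.9.2]: for a group acting transitively, "the cycles
> `φ_g(V) · W` represent the class `V · W`" for generic `g`; [Fulton1998, §8.2 (8.8)]: "`∫_Y V · W = Σ_P i(P; V · W; Y)`";
> [Fulton1998, §7.1 Prop. 7.1 (a)]: "`1 ≤ i(Z; V₁ · … · V_r; X)`". [GriffithsHarris1978, Ch. 0 §4]: the number of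
> sheets of a finite holomorphic map is the number of preimages of a generic point. [Chirka1989, §3.7 and §11.1:
> the multiplicity of an analytic covering `pr : Z → U`; "over `U ∖ σ` the fibres consist of exactly `k` points",
> §12.3: intersection indices.]

For closed analytic `Z ⊆ X₁ × X₂` of pure dimension `dim X₂` (so `pr₂|_Z` is generically finite):

* §1 (private) the translate-intersections `(X₁ × {0}) ∩ (Z − ŝ)` and `(X₁ × {t₀}) ∩ Z` on `X₁ × X₂` are copies
  of the fibres `Z_{pr₂ ŝ}`, `Z_{t₀}`; Haar measure on `X₁ × X₂` projects to Haar measure on `X₂`;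
  `analyticCycleClass_univ_prod_singleton_eq` — `[X₁ × {t₀}] = [X₁ × {0}]`;
* §2 **`ae_finite_fibreSlice_and_wedge_eq_ncard_smul_volumeForm`** — for almost every `t ∈ X₂` the fibre `Z_t`
  is finite and `[X₁ × {0}]_ê ∧ [Z]_ê = #Z_t · vol_ê`; **`exists_degree_fibreSlice`** — THE DEGREE `deg(Z/X₂)`:
  there is `N : ℕ` with `#Z_t = N` for almost every `t` and `[X₁ × {0}] ∧ [Z] = N · vol`;
* §3 **`ncard_fibreSlice_le_degree`** — a FINITE special fibre has at most `deg(Z/X₂)` points (each counted with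
  a positive multiplicity, `exists_wedge_analyticCycleClass_eq_smul_volumeForm_of_hasPureDim_zero`);
  **`ncard_fibreSlice_eq_degree_of_subsingleton`** — it has exactly `deg(Z/X₂)` points when each of its points
  deforms to at most one point of the nearby fibres (e.g. `pr₂|_Z` étale there);
* §4 **`one_le_degree_iff_forall_fibreSlice_nonempty`** — `deg(Z/X₂) ≥ 1 ⟺` every fibre is non-empty
  (`⟺ pr₂(Z) = X₂`).

## References

* [Fulton1998] W. Fulton, *Intersection Theory*, 2nd ed., Springer 1998, §7.1 Prop. 7.1, §8.2 (8.8),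
  Example 11.4.5, Appendix B.9.2.
* [GriffithsHarris1978] P. Griffiths, J. Harris, *Principles of Algebraic Geometry*, Wiley 1978, Ch. 0 §4,
  Ch. 5 (finite maps, sheet numbers).
* [Chirka1989] E. M. Chirka, *Complex Analytic Sets*, Kluwer 1989, §3.7, §11.1, §12.3.
* [Kleiman1974Transversality] S. L. Kleiman, *The transversality of a general translate*, Compositio Math. 28
  (1974), Thm. 2.
* [Federer1969] H. Federer, *Geometric Measure Theory*, 2.6.2 (2).
-/

noncomputable section

open scoped Manifold Topology
open MeasureTheory Set Function Module WithLp
open Literature.LinearAlgebra.Alternating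

namespace Literature.Geometry.Kaehler
namespace ComplexTorus

universe u

variable {ι₁ ι₂ : Type*} [Fintype ι₁] [Fintype ι₂] [DecidableEq ι₁] [DecidableEq ι₂]
  {E₁ : Type u} [NormedAddCommGroup E₁] [InnerProductSpace ℂ E₁] [FiniteDimensional ℂ E₁]
  [MeasurableSpace E₁] [BorelSpace E₁]
  {E₂ : Type u} [NormedAddCommGroup E₂] [InnerProductSpace ℂ E₂] [FiniteDimensional ℂ E₂]
  [MeasurableSpace E₂] [BorelSpace E₂]
  (Φ₁ : (ι₁ → ℝ) ≃L[ℝ] E₁) (Φ₂ : (ι₂ → ℝ) ≃L[ℝ] E₂) {n₁ n₂ : ℕ} (e₁ : Fin n₁ ≃ ι₁) (e₂ : Fin n₂ ≃ ι₂)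
  {q₁ p : ℕ}

/-! ### §1 Fibres as intersections with the translates of `X₁ × {0}` -/

omit [DecidableEq ι₁] [DecidableEq ι₂] [FiniteDimensional ℂ E₁] [MeasurableSpace E₁] [BorelSpace E₁]
  [FiniteDimensional ℂ E₂] [MeasurableSpace E₂] [BorelSpace E₂] in
/-- `(X₁ × {0}) ∩ (Z − ŝ)` is the image of the fibre `Z_{pr₂ ŝ}` under `x ↦ (x − pr₁ ŝ, 0)`. [folklore] -/
private theorem image_fibreSlice_eq_inter_translate (Z : Set (ComplexTorus (prodPeriodL2 Φ₁ Φ₂)))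
    (s : ComplexTorus (prodPeriodL2 Φ₁ Φ₂)) :
    (fun x : ComplexTorus Φ₁ => (prodHomeomorphL2 Φ₁ Φ₂).symm (x - (prodHomeomorphL2 Φ₁ Φ₂ s).1, 0)) ''
        {x : ComplexTorus Φ₁ | (prodHomeomorphL2 Φ₁ Φ₂).symm (x, (prodHomeomorphL2 Φ₁ Φ₂ s).2) ∈ Z} =
      prodHomeomorphL2 Φ₁ Φ₂ ⁻¹' ((univ : Set (ComplexTorus Φ₁)) ×ˢ ({0} : Set (ComplexTorus Φ₂))) ∩
        (fun z ↦ z + s) ⁻¹' Z := by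
  ext z
  simp only [mem_image, mem_setOf_eq, mem_inter_iff, mem_preimage, mem_prod, mem_univ, true_and,
    mem_singleton_iff]
  constructor
  · rintro ⟨x, hx, rfl⟩
    refine ⟨by rw [Homeomorph.apply_symm_apply], ?_⟩
    have h : (prodHomeomorphL2 Φ₁ Φ₂).symm (x - (prodHomeomorphL2 Φ₁ Φ₂ s).1, 0) + s =
        (prodHomeomorphL2 Φ₁ Φ₂).symm (x, (prodHomeomorphL2 Φ₁ Φ₂ s).2) := by
      apply (prodHomeomorphL2 Φ₁ Φ₂).injective
      rw [prodHomeomorphL2_add, Homeomorph.apply_symm_apply, Homeomorph.apply_symm_apply, Prod.mk_add_mk,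
        sub_add_cancel, zero_add]
    rw [h]
    exact hx
  · rintro ⟨hz0, hzs⟩
    refine ⟨(prodHomeomorphL2 Φ₁ Φ₂ z).1 + (prodHomeomorphL2 Φ₁ Φ₂ s).1, ?_, ?_⟩
    · have h : (prodHomeomorphL2 Φ₁ Φ₂).symm
          ((prodHomeomorphL2 Φ₁ Φ₂ z).1 + (prodHomeomorphL2 Φ₁ Φ₂ s).1, (prodHomeomorphL2 Φ₁ Φ₂ s).2) = z + s := by
        apply (prodHomeomorphL2 Φ₁ Φ₂).injective
        rw [Homeomorph.apply_symm_apply, prodHomeomorphL2_add, Prod.ext_iff]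
        exact ⟨rfl, by simp [hz0]⟩
      rw [h]
      exact hzs
    · rw [add_sub_cancel_right]
      apply (prodHomeomorphL2 Φ₁ Φ₂).injective
      rw [Homeomorph.apply_symm_apply, Prod.ext_iff]
      exact ⟨rfl, hz0.symm⟩

omit [DecidableEq ι₁] [DecidableEq ι₂] [FiniteDimensional ℂ E₁] [MeasurableSpace E₁] [BorelSpace E₁]
  [FiniteDimensional ℂ E₂] [MeasurableSpace E₂] [BorelSpace E₂] in
/-- `(X₁ × {t₀}) ∩ Z` is the image of the fibre `Z_{t₀}` under `x ↦ (x, t₀)`. [folklore] -/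
private theorem image_fibreSlice_eq_inter (Z : Set (ComplexTorus (prodPeriodL2 Φ₁ Φ₂))) (t₀ : ComplexTorus Φ₂) :
    (fun x : ComplexTorus Φ₁ => (prodHomeomorphL2 Φ₁ Φ₂).symm (x, t₀)) ''
        {x : ComplexTorus Φ₁ | (prodHomeomorphL2 Φ₁ Φ₂).symm (x, t₀) ∈ Z} =
      prodHomeomorphL2 Φ₁ Φ₂ ⁻¹' ((univ : Set (ComplexTorus Φ₁)) ×ˢ ({t₀} : Set (ComplexTorus Φ₂))) ∩ Z := by
  ext z
  simp only [mem_image, mem_setOf_eq, mem_inter_iff, mem_preimage, mem_prod, mem_univ, true_and,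
    mem_singleton_iff]
  constructor
  · rintro ⟨x, hx, rfl⟩
    exact ⟨by rw [Homeomorph.apply_symm_apply], hx⟩
  · rintro ⟨hz0, hz⟩
    refine ⟨(prodHomeomorphL2 Φ₁ Φ₂ z).1, ?_, ?_⟩
    · have h : (prodHomeomorphL2 Φ₁ Φ₂).symm ((prodHomeomorphL2 Φ₁ Φ₂ z).1, t₀) = z := by
        apply (prodHomeomorphL2 Φ₁ Φ₂).injective
        rw [Homeomorph.apply_symm_apply, Prod.ext_iff]
        exact ⟨rfl, hz0.symm⟩
      rw [h]
      exact hz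
    · apply (prodHomeomorphL2 Φ₁ Φ₂).injective
      rw [Homeomorph.apply_symm_apply, Prod.ext_iff]
      exact ⟨rfl, hz0.symm⟩

omit [DecidableEq ι₁] [DecidableEq ι₂] [FiniteDimensional ℂ E₁] [MeasurableSpace E₁] [BorelSpace E₁]
  [FiniteDimensional ℂ E₂] [MeasurableSpace E₂] [BorelSpace E₂] in
/-- `(X₁ × {t₀}) ∩ Z = (Z_{t₀} × {t₀})` read through `prodHomeomorphL2`. [folklore] -/
private theorem inter_eq_preimage_fibreSlice_prod_singleton (Z : Set (ComplexTorus (prodPeriodL2 Φ₁ Φ₂)))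
    (t₀ : ComplexTorus Φ₂) :
    prodHomeomorphL2 Φ₁ Φ₂ ⁻¹' ((univ : Set (ComplexTorus Φ₁)) ×ˢ ({t₀} : Set (ComplexTorus Φ₂))) ∩ Z =
      prodHomeomorphL2 Φ₁ Φ₂ ⁻¹'
        ({x : ComplexTorus Φ₁ | (prodHomeomorphL2 Φ₁ Φ₂).symm (x, t₀) ∈ Z} ×ˢ ({t₀} : Set (ComplexTorus Φ₂))) := by
  ext z
  simp only [mem_inter_iff, mem_preimage, mem_prod, mem_univ, true_and, mem_singleton_iff, mem_setOf_eq]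
  constructor
  · rintro ⟨hz0, hz⟩
    refine ⟨?_, hz0⟩
    have h : (prodHomeomorphL2 Φ₁ Φ₂).symm ((prodHomeomorphL2 Φ₁ Φ₂ z).1, t₀) = z := by
      apply (prodHomeomorphL2 Φ₁ Φ₂).injective
      rw [Homeomorph.apply_symm_apply, Prod.ext_iff]
      exact ⟨rfl, hz0.symm⟩
    rw [h]
    exact hz
  · rintro ⟨hz, hz0⟩
    refine ⟨hz0, ?_⟩
    have h : (prodHomeomorphL2 Φ₁ Φ₂).symm ((prodHomeomorphL2 Φ₁ Φ₂ z).1, t₀) = z := by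
      apply (prodHomeomorphL2 Φ₁ Φ₂).injective
      rw [Homeomorph.apply_symm_apply, Prod.ext_iff]
      exact ⟨rfl, hz0.symm⟩
    rw [← h]
    exact hz

omit [DecidableEq ι₁] [DecidableEq ι₂] [FiniteDimensional ℂ E₁] [MeasurableSpace E₁] [BorelSpace E₁]
  [FiniteDimensional ℂ E₂] [MeasurableSpace E₂] [BorelSpace E₂] in
/-- **Haar measure on `X₁ × X₂` projects to Haar measure on `X₂`** (null sets; `(α × β)(A × B) = α(A) · β(B)`).
[cite: Federer1969, 2.6.2 (2)] -/
theorem ae_of_ae_comp_snd_prodHomeomorphL2 {R : ComplexTorus Φ₂ → Prop}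
    (h : ∀ᵐ s ∂(volume : Measure (ComplexTorus (prodPeriodL2 Φ₁ Φ₂))), R (prodHomeomorphL2 Φ₁ Φ₂ s).2) :
    ∀ᵐ t ∂(volume : Measure (ComplexTorus Φ₂)), R t := by
  rw [ae_iff] at h ⊢
  set eM : ComplexTorus (prodPeriodL2 Φ₁ Φ₂) ≃ᵐ ComplexTorus Φ₁ × ComplexTorus Φ₂ :=
    MeasurableEquiv.sumPiEquivProdPi fun _ : ι₁ ⊕ ι₂ => AddCircle (1 : ℝ) with heM
  have hmp : MeasurePreserving eM (volume : Measure (ComplexTorus (prodPeriodL2 Φ₁ Φ₂)))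
      ((volume : Measure (ComplexTorus Φ₁)).prod (volume : Measure (ComplexTorus Φ₂))) :=
    volume_measurePreserving_sumPiEquivProdPi fun _ : ι₁ ⊕ ι₂ => AddCircle (1 : ℝ)
  have hset : {s : ComplexTorus (prodPeriodL2 Φ₁ Φ₂) | ¬R (prodHomeomorphL2 Φ₁ Φ₂ s).2} =
      eM ⁻¹' ((univ : Set (ComplexTorus Φ₁)) ×ˢ {t : ComplexTorus Φ₂ | ¬R t}) := by
    ext s
    simp only [mem_setOf_eq, mem_preimage, mem_prod, mem_univ, true_and]
    rfl
  rw [hset, hmp.measure_preimage_equiv, Measure.prod_prod, measure_univ, one_mul] at h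
  exact h

/-- **`[X₁ × {t₀}] = [X₁ × {0}]`**: the classes of the horizontal slices agree (both are `± pr₂^* vol_{e₂}`).
[cite: Fulton1998, §19.2 Cor. 19.2 (b) and Example 19.1.9] -/
theorem analyticCycleClass_univ_prod_singleton_eq (hL : 2 * (finrank ℂ E₁ + 0) + 2 * q₁ = n₁ + n₂)
    (t₀ : ComplexTorus Φ₂) :
    analyticCycleClass (prodPeriodL2 Φ₁ Φ₂) (sumEnum e₁ e₂) hL
        (hasPureDim_preimage_prodHomeomorphL2_univ_prod Φ₁ Φ₂ (hasPureDim_singleton t₀)) =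
      analyticCycleClass (prodPeriodL2 Φ₁ Φ₂) (sumEnum e₁ e₂) hL
        (hasPureDim_preimage_prodHomeomorphL2_univ_prod Φ₁ Φ₂ (hasPureDim_singleton (0 : ComplexTorus Φ₂))) := by
  have hng₁ : finrank ℂ E₁ * 2 = n₁ := finrank_complex_mul_two Φ₁ e₁
  have hn₁ : 2 * finrank ℂ E₁ + 0 = n₁ := by omega
  have hk₂ : 2 * 0 + 2 * q₁ = n₂ := by omega
  rw [analyticCycleClass_prodL2_univ_prod Φ₁ Φ₂ e₁ e₂ (hasPureDim_singleton t₀) hn₁ hk₂ hL,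
    analyticCycleClass_prodL2_univ_prod Φ₁ Φ₂ e₁ e₂ (hasPureDim_singleton (0 : ComplexTorus Φ₂)) hn₁ hk₂ hL,
    analyticCycleClass_singleton_eq_smul_volumeForm, analyticCycleClass_singleton_eq_smul_volumeForm]

/-! ### §2 The degree: generic fibres -/

/-- **`[X₁ × {0}] · [Z] = #Z_t · vol` for almost every `t ∈ X₂`, with `Z_t` finite**: for `Z ⊆ X₁ × X₂` closed
analytic of pure dimension `dim X₂`, almost every fibre of `pr₂|_Z` is finite and its cardinality is the intersection
number of `Z` with the horizontal slice (`ComplexTorusAnalyticIntersectionNumber` §3 on `X₁ × X₂` for the pair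
`(X₁ × {0}, Z)`: the translate-intersections `(X₁ × {0}) ∩ (Z − ŝ)` are copies of the fibres `Z_{pr₂ ŝ}`).
[cite: Fulton1998, §8.2 (8.8) and Example 11.4.5] [cite: Kleiman1974Transversality, Thm. 2]
[cite: GriffithsHarris1978, Ch. 0 §4] [cite: Chirka1989, §3.7 and §11.1] -/
theorem ae_finite_fibreSlice_and_wedge_eq_ncard_smul_volumeForm (hE₂ : 0 < finrank ℂ E₂)
    (hL : 2 * (finrank ℂ E₁ + 0) + 2 * q₁ = n₁ + n₂) (hkZ : 2 * finrank ℂ E₂ + 2 * p = n₁ + n₂)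
    (h0 : 2 * 0 + 2 * (q₁ + p) = n₁ + n₂)
    {Z : Set (ComplexTorus (prodPeriodL2 Φ₁ Φ₂))} (hZ : HasPureDim 𝓘(ℂ, WithLp 2 (E₁ × E₂)) Z (finrank ℂ E₂)) :
    ∀ᵐ t ∂(volume : Measure (ComplexTorus Φ₂)),
      {x : ComplexTorus Φ₁ | (prodHomeomorphL2 Φ₁ Φ₂).symm (x, t) ∈ Z}.Finite ∧
        ((analyticCycleClass (prodPeriodL2 Φ₁ Φ₂) (sumEnum e₁ e₂) hL
            (hasPureDim_preimage_prodHomeomorphL2_univ_prod Φ₁ Φ₂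
              (hasPureDim_singleton (0 : ComplexTorus Φ₂)))).wedge
          (analyticCycleClass (prodPeriodL2 Φ₁ Φ₂) (sumEnum e₁ e₂) hkZ hZ)).domDomCongr
            (finCongr (by ring : 2 * q₁ + 2 * p = 2 * (q₁ + p))) =
          ({x : ComplexTorus Φ₁ | (prodHomeomorphL2 Φ₁ Φ₂).symm (x, t) ∈ Z}.ncard : ℂ) •
            volumeForm (prodPeriodL2 Φ₁ Φ₂) ((finCongr (by omega : 2 * (q₁ + p) = n₁ + n₂)).trans (sumEnum e₁ e₂)) := by
  have hE : 0 < finrank ℂ (WithLp 2 (E₁ × E₂)) := by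
    rw [(WithLp.prodContinuousLinearEquiv 2 ℂ E₁ E₂).toLinearEquiv.finrank_eq, Module.finrank_prod]
    omega
  have h := ae_finite_inter_translate_and_wedge_eq_ncard_smul_volumeForm (prodPeriodL2 Φ₁ Φ₂) (sumEnum e₁ e₂)
    hE hL hkZ h0 (hasPureDim_preimage_prodHomeomorphL2_univ_prod Φ₁ Φ₂ (hasPureDim_singleton (0 : ComplexTorus Φ₂))) hZ
  have hinj : ∀ s : ComplexTorus (prodPeriodL2 Φ₁ Φ₂), Function.Injective
      fun x : ComplexTorus Φ₁ => (prodHomeomorphL2 Φ₁ Φ₂).symm (x - (prodHomeomorphL2 Φ₁ Φ₂ s).1, 0) := by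
    intro s x y hxy
    have h1 := congrArg (fun z => (prodHomeomorphL2 Φ₁ Φ₂ z).1) hxy
    simpa using h1
  refine ae_of_ae_comp_snd_prodHomeomorphL2 Φ₁ Φ₂ ?_
  filter_upwards [h] with s hs
  rw [← image_fibreSlice_eq_inter_translate Φ₁ Φ₂ Z s, Set.ncard_image_of_injective _ (hinj s),
    Set.finite_image_iff (hinj s).injOn] at hs
  exact hs

/-- **THE DEGREE OF `Z` OVER `X₂`**: for `Z ⊆ X₁ × X₂` closed analytic of pure dimension `dim X₂` there is a natural
number `N = deg(Z/X₂)` such that almost every fibre `Z_t` is finite with EXACTLY `N` points, and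
`[X₁ × {0}]_ê ∧ [Z]_ê = N · vol_ê` (the number of sheets of the generically finite map `pr₂|_Z`).
[cite: GriffithsHarris1978, Ch. 0 §4] [cite: Chirka1989, §3.7 and §11.1] [cite: Fulton1998, Example 11.4.5] -/
theorem exists_degree_fibreSlice (hE₂ : 0 < finrank ℂ E₂)
    (hL : 2 * (finrank ℂ E₁ + 0) + 2 * q₁ = n₁ + n₂) (hkZ : 2 * finrank ℂ E₂ + 2 * p = n₁ + n₂)
    (h0 : 2 * 0 + 2 * (q₁ + p) = n₁ + n₂)
    {Z : Set (ComplexTorus (prodPeriodL2 Φ₁ Φ₂))} (hZ : HasPureDim 𝓘(ℂ, WithLp 2 (E₁ × E₂)) Z (finrank ℂ E₂)) :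
    ∃ N : ℕ, (∀ᵐ t ∂(volume : Measure (ComplexTorus Φ₂)),
        {x : ComplexTorus Φ₁ | (prodHomeomorphL2 Φ₁ Φ₂).symm (x, t) ∈ Z}.Finite ∧
          {x : ComplexTorus Φ₁ | (prodHomeomorphL2 Φ₁ Φ₂).symm (x, t) ∈ Z}.ncard = N) ∧
      ((analyticCycleClass (prodPeriodL2 Φ₁ Φ₂) (sumEnum e₁ e₂) hL
          (hasPureDim_preimage_prodHomeomorphL2_univ_prod Φ₁ Φ₂
            (hasPureDim_singleton (0 : ComplexTorus Φ₂)))).wedge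
        (analyticCycleClass (prodPeriodL2 Φ₁ Φ₂) (sumEnum e₁ e₂) hkZ hZ)).domDomCongr
          (finCongr (by ring : 2 * q₁ + 2 * p = 2 * (q₁ + p))) =
        (N : ℂ) • volumeForm (prodPeriodL2 Φ₁ Φ₂) ((finCongr (by omega : 2 * (q₁ + p) = n₁ + n₂)).trans (sumEnum e₁ e₂)) := by
  have h := ae_finite_fibreSlice_and_wedge_eq_ncard_smul_volumeForm Φ₁ Φ₂ e₁ e₂ hE₂ hL hkZ h0 hZ
  obtain ⟨t₀, ht₀⟩ := h.exists
  refine ⟨{x : ComplexTorus Φ₁ | (prodHomeomorphL2 Φ₁ Φ₂).symm (x, t₀) ∈ Z}.ncard, ?_, ht₀.2⟩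
  have hvol : volumeForm (prodPeriodL2 Φ₁ Φ₂)
      ((finCongr (by omega : 2 * (q₁ + p) = n₁ + n₂)).trans (sumEnum e₁ e₂)) ≠ 0 := fun hv => by
    have h1 := torusIntegral_volumeForm (prodPeriodL2 Φ₁ Φ₂)
      ((finCongr (by omega : 2 * (q₁ + p) = n₁ + n₂)).trans (sumEnum e₁ e₂))
    rw [hv, torusIntegral_zero] at h1
    exact zero_ne_one h1
  filter_upwards [h] with t ht
  refine ⟨ht.1, ?_⟩
  have h2 := ht.2.symm.trans ht₀.2
  exact_mod_cast smul_left_injective ℂ hvol h2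

/-! ### §3 Special fibres -/

/-- **A finite special fibre has at most `deg(Z/X₂)` points** — each of its points carries a POSITIVE multiplicity and
the multiplicities add up to the degree (`ComplexTorusAnalyticIntersectionNumber` §2 for `(X₁ × {t₀}, Z)`, and
`[X₁ × {t₀}] = [X₁ × {0}]`). [cite: Fulton1998, §7.1 Prop. 7.1 (a) and §8.2 (8.8)] [cite: GriffithsHarris1978, Ch. 0 §4]
[cite: Chirka1989, §11.1 and §12.3] -/
theorem ncard_fibreSlice_le_degree (hE₂ : 0 < finrank ℂ E₂)
    (hL : 2 * (finrank ℂ E₁ + 0) + 2 * q₁ = n₁ + n₂) (hkZ : 2 * finrank ℂ E₂ + 2 * p = n₁ + n₂)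
    (h0 : 2 * 0 + 2 * (q₁ + p) = n₁ + n₂)
    {Z : Set (ComplexTorus (prodPeriodL2 Φ₁ Φ₂))} (hZ : HasPureDim 𝓘(ℂ, WithLp 2 (E₁ × E₂)) Z (finrank ℂ E₂))
    {N : ℕ} (hN : ((analyticCycleClass (prodPeriodL2 Φ₁ Φ₂) (sumEnum e₁ e₂) hL
          (hasPureDim_preimage_prodHomeomorphL2_univ_prod Φ₁ Φ₂
            (hasPureDim_singleton (0 : ComplexTorus Φ₂)))).wedge
        (analyticCycleClass (prodPeriodL2 Φ₁ Φ₂) (sumEnum e₁ e₂) hkZ hZ)).domDomCongr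
          (finCongr (by ring : 2 * q₁ + 2 * p = 2 * (q₁ + p))) =
        (N : ℂ) • volumeForm (prodPeriodL2 Φ₁ Φ₂) ((finCongr (by omega : 2 * (q₁ + p) = n₁ + n₂)).trans (sumEnum e₁ e₂)))
    {t₀ : ComplexTorus Φ₂}
    (hF : HasPureDim 𝓘(ℂ, E₁) {x : ComplexTorus Φ₁ | (prodHomeomorphL2 Φ₁ Φ₂).symm (x, t₀) ∈ Z} 0) :
    {x : ComplexTorus Φ₁ | (prodHomeomorphL2 Φ₁ Φ₂).symm (x, t₀) ∈ Z}.ncard ≤ N := by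
  classical
  have hE : 0 < finrank ℂ (WithLp 2 (E₁ × E₂)) := by
    rw [(WithLp.prodContinuousLinearEquiv 2 ℂ E₁ E₂).toLinearEquiv.finrank_eq, Module.finrank_prod]
    omega
  -- `(X₁ × {t₀}) ∩ Z = Z_{t₀} × {t₀}` has pure dimension `0`
  have hI : HasPureDim 𝓘(ℂ, WithLp 2 (E₁ × E₂))
      (prodHomeomorphL2 Φ₁ Φ₂ ⁻¹' ((univ : Set (ComplexTorus Φ₁)) ×ˢ ({t₀} : Set (ComplexTorus Φ₂))) ∩ Z) 0 := by
    rw [inter_eq_preimage_fibreSlice_prod_singleton]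
    exact hasPureDim_preimage_prodHomeomorphL2_prod_singleton Φ₁ Φ₂ hF t₀
  obtain ⟨i, -, hle, hcl⟩ := exists_wedge_analyticCycleClass_eq_smul_volumeForm_of_hasPureDim_zero
    (prodPeriodL2 Φ₁ Φ₂) (sumEnum e₁ e₂) hE hL hkZ h0
    (hasPureDim_preimage_prodHomeomorphL2_univ_prod Φ₁ Φ₂ (hasPureDim_singleton t₀)) hZ hI
  rw [analyticCycleClass_univ_prod_singleton_eq Φ₁ Φ₂ e₁ e₂ hL t₀, hN] at hcl
  have hvol : volumeForm (prodPeriodL2 Φ₁ Φ₂)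
      ((finCongr (by omega : 2 * (q₁ + p) = n₁ + n₂)).trans (sumEnum e₁ e₂)) ≠ 0 := fun hv => by
    have h1 := torusIntegral_volumeForm (prodPeriodL2 Φ₁ Φ₂)
      ((finCongr (by omega : 2 * (q₁ + p) = n₁ + n₂)).trans (sumEnum e₁ e₂))
    rw [hv, torusIntegral_zero] at h1
    exact zero_ne_one h1
  have hsum : ((N : ℤ) : ℂ) = ((∑ x ∈ (finite_of_hasPureDim_zero (prodPeriodL2 Φ₁ Φ₂) hI).toFinset, i x : ℤ) : ℂ) := by
    have h := smul_left_injective ℂ hvol hcl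
    exact_mod_cast h
  have hsum' : (∑ x ∈ (finite_of_hasPureDim_zero (prodPeriodL2 Φ₁ Φ₂) hI).toFinset, i x : ℤ) = N := by
    exact_mod_cast hsum.symm
  -- `#((X₁ × {t₀}) ∩ Z) = #Z_{t₀}`
  have hinj : Function.Injective fun x : ComplexTorus Φ₁ => (prodHomeomorphL2 Φ₁ Φ₂).symm (x, t₀) := by
    intro x y hxy
    have h1 := congrArg (fun z => (prodHomeomorphL2 Φ₁ Φ₂ z).1) hxy
    simpa using h1
  have hcard : (prodHomeomorphL2 Φ₁ Φ₂ ⁻¹' ((univ : Set (ComplexTorus Φ₁)) ×ˢ ({t₀} : Set (ComplexTorus Φ₂))) ∩ Z).ncard =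
      {x : ComplexTorus Φ₁ | (prodHomeomorphL2 Φ₁ Φ₂).symm (x, t₀) ∈ Z}.ncard := by
    rw [← image_fibreSlice_eq_inter Φ₁ Φ₂ Z t₀, Set.ncard_image_of_injective _ hinj]
  have h := hle
  rw [hcard, hsum'] at h
  exact_mod_cast h

/-- **A special fibre whose points deform to at most one point has exactly `deg(Z/X₂)` points** (multiplicity one,
e.g. where `pr₂|_Z` is étale: `ComplexTorusAnalyticIntersectionNumber` §4–§5 on `X₁ × X₂`).
[cite: GriffithsHarris1978, Ch. 0 §4] [cite: Fulton1998, §8.2 Prop. 8.2] [cite: Chirka1989, §11.1] -/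
theorem ncard_fibreSlice_eq_degree_of_subsingleton (hE₂ : 0 < finrank ℂ E₂)
    (hL : 2 * (finrank ℂ E₁ + 0) + 2 * q₁ = n₁ + n₂) (hkZ : 2 * finrank ℂ E₂ + 2 * p = n₁ + n₂)
    (h0 : 2 * 0 + 2 * (q₁ + p) = n₁ + n₂)
    {Z : Set (ComplexTorus (prodPeriodL2 Φ₁ Φ₂))} (hZ : HasPureDim 𝓘(ℂ, WithLp 2 (E₁ × E₂)) Z (finrank ℂ E₂))
    {N : ℕ} (hN : ((analyticCycleClass (prodPeriodL2 Φ₁ Φ₂) (sumEnum e₁ e₂) hL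
          (hasPureDim_preimage_prodHomeomorphL2_univ_prod Φ₁ Φ₂
            (hasPureDim_singleton (0 : ComplexTorus Φ₂)))).wedge
        (analyticCycleClass (prodPeriodL2 Φ₁ Φ₂) (sumEnum e₁ e₂) hkZ hZ)).domDomCongr
          (finCongr (by ring : 2 * q₁ + 2 * p = 2 * (q₁ + p))) =
        (N : ℂ) • volumeForm (prodPeriodL2 Φ₁ Φ₂) ((finCongr (by omega : 2 * (q₁ + p) = n₁ + n₂)).trans (sumEnum e₁ e₂)))
    {t₀ : ComplexTorus Φ₂}
    (hF : HasPureDim 𝓘(ℂ, E₁) {x : ComplexTorus Φ₁ | (prodHomeomorphL2 Φ₁ Φ₂).symm (x, t₀) ∈ Z} 0)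
    (hone : ∀ z ∈ prodHomeomorphL2 Φ₁ Φ₂ ⁻¹' ((univ : Set (ComplexTorus Φ₁)) ×ˢ ({t₀} : Set (ComplexTorus Φ₂))) ∩ Z,
      ∃ U ∈ 𝓝 z, ∀ᶠ s in 𝓝 (0 : ComplexTorus (prodPeriodL2 Φ₁ Φ₂)),
        (U ∩ prodHomeomorphL2 Φ₁ Φ₂ ⁻¹' ((univ : Set (ComplexTorus Φ₁)) ×ˢ ({t₀} : Set (ComplexTorus Φ₂))) ∩
          (fun z ↦ z + s) ⁻¹' Z).Subsingleton) :
    {x : ComplexTorus Φ₁ | (prodHomeomorphL2 Φ₁ Φ₂).symm (x, t₀) ∈ Z}.ncard = N := by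
  have hE : 0 < finrank ℂ (WithLp 2 (E₁ × E₂)) := by
    rw [(WithLp.prodContinuousLinearEquiv 2 ℂ E₁ E₂).toLinearEquiv.finrank_eq, Module.finrank_prod]
    omega
  have hI : HasPureDim 𝓘(ℂ, WithLp 2 (E₁ × E₂))
      (prodHomeomorphL2 Φ₁ Φ₂ ⁻¹' ((univ : Set (ComplexTorus Φ₁)) ×ˢ ({t₀} : Set (ComplexTorus Φ₂))) ∩ Z) 0 := by
    rw [inter_eq_preimage_fibreSlice_prod_singleton]
    exact hasPureDim_preimage_prodHomeomorphL2_prod_singleton Φ₁ Φ₂ hF t₀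
  have hcl := wedge_analyticCycleClass_eq_ncard_smul_volumeForm_of_subsingleton (prodPeriodL2 Φ₁ Φ₂) (sumEnum e₁ e₂)
    hE hL hkZ h0 (hasPureDim_preimage_prodHomeomorphL2_univ_prod Φ₁ Φ₂ (hasPureDim_singleton t₀)) hZ hI hone
  rw [analyticCycleClass_univ_prod_singleton_eq Φ₁ Φ₂ e₁ e₂ hL t₀, hN] at hcl
  have hvol : volumeForm (prodPeriodL2 Φ₁ Φ₂)
      ((finCongr (by omega : 2 * (q₁ + p) = n₁ + n₂)).trans (sumEnum e₁ e₂)) ≠ 0 := fun hv => by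
    have h1 := torusIntegral_volumeForm (prodPeriodL2 Φ₁ Φ₂)
      ((finCongr (by omega : 2 * (q₁ + p) = n₁ + n₂)).trans (sumEnum e₁ e₂))
    rw [hv, torusIntegral_zero] at h1
    exact zero_ne_one h1
  have hinj : Function.Injective fun x : ComplexTorus Φ₁ => (prodHomeomorphL2 Φ₁ Φ₂).symm (x, t₀) := by
    intro x y hxy
    have h1 := congrArg (fun z => (prodHomeomorphL2 Φ₁ Φ₂ z).1) hxy
    simpa using h1
  have hcard : (prodHomeomorphL2 Φ₁ Φ₂ ⁻¹' ((univ : Set (ComplexTorus Φ₁)) ×ˢ ({t₀} : Set (ComplexTorus Φ₂))) ∩ Z).ncard =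
      {x : ComplexTorus Φ₁ | (prodHomeomorphL2 Φ₁ Φ₂).symm (x, t₀) ∈ Z}.ncard := by
    rw [← image_fibreSlice_eq_inter Φ₁ Φ₂ Z t₀, Set.ncard_image_of_injective _ hinj]
  have h := smul_left_injective ℂ hvol hcl
  rw [hcard] at h
  exact_mod_cast h.symm

/-! ### §4 `deg(Z/X₂) ≥ 1 ⟺ pr₂(Z) = X₂` -/

omit [DecidableEq ι₁] [DecidableEq ι₂] [FiniteDimensional ℂ E₁] [MeasurableSpace E₁] [BorelSpace E₁]
  [FiniteDimensional ℂ E₂] [MeasurableSpace E₂] [BorelSpace E₂] in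
/-- The `t ∈ X₂` with empty fibre `Z_t` form an open set, for `Z ⊆ X₁ × X₂` closed (`pr₂(Z)` is compact).
[cite: Fulton1998, §11.1 Cor. 11.1] -/
private theorem isOpen_setOf_fibreSlice_eq_empty {Z : Set (ComplexTorus (prodPeriodL2 Φ₁ Φ₂))} (hZ : IsClosed Z) :
    IsOpen {t : ComplexTorus Φ₂ | {x : ComplexTorus Φ₁ | (prodHomeomorphL2 Φ₁ Φ₂).symm (x, t) ∈ Z} = ∅} := by
  have hc : IsClosed ((fun z ↦ (prodHomeomorphL2 Φ₁ Φ₂ z).2) '' Z) :=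
    (hZ.isCompact.image (continuous_snd.comp (prodHomeomorphL2 Φ₁ Φ₂).continuous)).isClosed
  have hset : {t : ComplexTorus Φ₂ | {x : ComplexTorus Φ₁ | (prodHomeomorphL2 Φ₁ Φ₂).symm (x, t) ∈ Z} = ∅} =
      ((fun z ↦ (prodHomeomorphL2 Φ₁ Φ₂ z).2) '' Z)ᶜ := by
    ext t
    simp only [mem_setOf_eq, mem_compl_iff, mem_image, eq_empty_iff_forall_notMem, not_exists, not_and]
    constructor
    · intro h z hz hzt
      refine h (prodHomeomorphL2 Φ₁ Φ₂ z).1 ?_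
      have hz' : (prodHomeomorphL2 Φ₁ Φ₂).symm ((prodHomeomorphL2 Φ₁ Φ₂ z).1, t) = z := by
        apply (prodHomeomorphL2 Φ₁ Φ₂).injective
        rw [Homeomorph.apply_symm_apply, Prod.ext_iff]
        exact ⟨rfl, hzt.symm⟩
      rw [hz']
      exact hz
    · intro h x hx
      exact h _ hx (by rw [Homeomorph.apply_symm_apply])
  rw [hset]
  exact hc.isOpen_compl

/-- **`deg(Z/X₂) ≥ 1 ⟺ every fibre is non-empty ⟺ pr₂(Z) = X₂`** for `Z ⊆ X₁ × X₂` closed analytic of pure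
dimension `dim X₂`: (⟸) the generic fibre has `deg` points and is non-empty; (⟹) the `t` with empty fibre form an
open set, of positive Haar measure if non-empty, while almost every fibre has `deg ≥ 1` points.
[cite: GriffithsHarris1978, Ch. 0 §4] [cite: Fulton1998, Example 11.4.5] [cite: Chirka1989, §3.7 and §11.1] -/
theorem one_le_degree_iff_forall_fibreSlice_nonempty (hE₂ : 0 < finrank ℂ E₂)
    (hL : 2 * (finrank ℂ E₁ + 0) + 2 * q₁ = n₁ + n₂) (hkZ : 2 * finrank ℂ E₂ + 2 * p = n₁ + n₂)
    (h0 : 2 * 0 + 2 * (q₁ + p) = n₁ + n₂)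
    {Z : Set (ComplexTorus (prodPeriodL2 Φ₁ Φ₂))} (hZ : HasPureDim 𝓘(ℂ, WithLp 2 (E₁ × E₂)) Z (finrank ℂ E₂))
    {N : ℕ} (hN : ((analyticCycleClass (prodPeriodL2 Φ₁ Φ₂) (sumEnum e₁ e₂) hL
          (hasPureDim_preimage_prodHomeomorphL2_univ_prod Φ₁ Φ₂
            (hasPureDim_singleton (0 : ComplexTorus Φ₂)))).wedge
        (analyticCycleClass (prodPeriodL2 Φ₁ Φ₂) (sumEnum e₁ e₂) hkZ hZ)).domDomCongr
          (finCongr (by ring : 2 * q₁ + 2 * p = 2 * (q₁ + p))) =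
        (N : ℂ) • volumeForm (prodPeriodL2 Φ₁ Φ₂) ((finCongr (by omega : 2 * (q₁ + p) = n₁ + n₂)).trans (sumEnum e₁ e₂))) :
    1 ≤ N ↔ ∀ t : ComplexTorus Φ₂, {x : ComplexTorus Φ₁ | (prodHomeomorphL2 Φ₁ Φ₂).symm (x, t) ∈ Z}.Nonempty := by
  have hae := ae_finite_fibreSlice_and_wedge_eq_ncard_smul_volumeForm Φ₁ Φ₂ e₁ e₂ hE₂ hL hkZ h0 hZ
  have hvol : volumeForm (prodPeriodL2 Φ₁ Φ₂)
      ((finCongr (by omega : 2 * (q₁ + p) = n₁ + n₂)).trans (sumEnum e₁ e₂)) ≠ 0 := fun hv => by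
    have h1 := torusIntegral_volumeForm (prodPeriodL2 Φ₁ Φ₂)
      ((finCongr (by omega : 2 * (q₁ + p) = n₁ + n₂)).trans (sumEnum e₁ e₂))
    rw [hv, torusIntegral_zero] at h1
    exact zero_ne_one h1
  -- on the full-measure set, `#Z_t = N`
  have hcount : ∀ t : ComplexTorus Φ₂,
      ({x : ComplexTorus Φ₁ | (prodHomeomorphL2 Φ₁ Φ₂).symm (x, t) ∈ Z}.Finite ∧
        ((analyticCycleClass (prodPeriodL2 Φ₁ Φ₂) (sumEnum e₁ e₂) hL
            (hasPureDim_preimage_prodHomeomorphL2_univ_prod Φ₁ Φ₂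
              (hasPureDim_singleton (0 : ComplexTorus Φ₂)))).wedge
          (analyticCycleClass (prodPeriodL2 Φ₁ Φ₂) (sumEnum e₁ e₂) hkZ hZ)).domDomCongr
            (finCongr (by ring : 2 * q₁ + 2 * p = 2 * (q₁ + p))) =
          ({x : ComplexTorus Φ₁ | (prodHomeomorphL2 Φ₁ Φ₂).symm (x, t) ∈ Z}.ncard : ℂ) •
            volumeForm (prodPeriodL2 Φ₁ Φ₂) ((finCongr (by omega : 2 * (q₁ + p) = n₁ + n₂)).trans (sumEnum e₁ e₂))) →
      {x : ComplexTorus Φ₁ | (prodHomeomorphL2 Φ₁ Φ₂).symm (x, t) ∈ Z}.ncard = N := by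
    intro t ht
    have h := hN.symm.trans ht.2
    exact_mod_cast (smul_left_injective ℂ hvol h).symm
  constructor
  · intro hN1 t
    by_contra hempty
    rw [not_nonempty_iff_eq_empty] at hempty
    have hopen := isOpen_setOf_fibreSlice_eq_empty Φ₁ Φ₂ hZ.isAnalyticSet.isClosed
    have hpos : (volume : Measure (ComplexTorus Φ₂))
        {t : ComplexTorus Φ₂ | {x : ComplexTorus Φ₁ | (prodHomeomorphL2 Φ₁ Φ₂).symm (x, t) ∈ Z} = ∅} ≠ 0 :=
      (hopen.measure_pos volume ⟨t, hempty⟩).ne'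
    obtain ⟨s, hs, hs'⟩ : ∃ s ∈ {t : ComplexTorus Φ₂ |
        {x : ComplexTorus Φ₁ | (prodHomeomorphL2 Φ₁ Φ₂).symm (x, t) ∈ Z} = ∅},
        {x : ComplexTorus Φ₁ | (prodHomeomorphL2 Φ₁ Φ₂).symm (x, s) ∈ Z}.Finite ∧
          ((analyticCycleClass (prodPeriodL2 Φ₁ Φ₂) (sumEnum e₁ e₂) hL
              (hasPureDim_preimage_prodHomeomorphL2_univ_prod Φ₁ Φ₂
                (hasPureDim_singleton (0 : ComplexTorus Φ₂)))).wedge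
            (analyticCycleClass (prodPeriodL2 Φ₁ Φ₂) (sumEnum e₁ e₂) hkZ hZ)).domDomCongr
              (finCongr (by ring : 2 * q₁ + 2 * p = 2 * (q₁ + p))) =
            ({x : ComplexTorus Φ₁ | (prodHomeomorphL2 Φ₁ Φ₂).symm (x, s) ∈ Z}.ncard : ℂ) •
              volumeForm (prodPeriodL2 Φ₁ Φ₂)
                ((finCongr (by omega : 2 * (q₁ + p) = n₁ + n₂)).trans (sumEnum e₁ e₂)) := by
      by_contra hcon
      exact hpos (measure_mono_null (fun s hs hP => hcon ⟨s, hs, hP⟩) (ae_iff.1 hae))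
    have h1 := hcount s hs'
    have hs0 : {x : ComplexTorus Φ₁ | (prodHomeomorphL2 Φ₁ Φ₂).symm (x, s) ∈ Z} = ∅ := hs
    rw [hs0, Set.ncard_empty] at h1
    omega
  · intro hall
    obtain ⟨t, ht⟩ := hae.exists
    rw [← hcount t ht]
    exact (Set.ncard_pos ht.1).2 (hall t)

end ComplexTorus
end Literature.Geometry.Kaehler

end
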